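import Summits.KontsevichZagierPeriods.KontsevichZagierPeriods.Theorems.RootDecompWalshStrataCone4Chart

/-!
# The cone specimen `x₃² > x₀² + x₁² + x₂²`, part 3/3: descent of `Π` to the quarter disc and assembly

Route `RootDecompWalshStrata` (cell decomp-kz, lens 4, gen 11), support toward `QuadricSignKernel`
(item stmt-KontsevichZagierPeriods-25393), slice `d = 4`.  The chart cell
`Π = {(a,b) ∈ Q, 0 < r < 1/(1 + a² + b²)}` is the open band over the quarter disc `Q` with the
RATIONAL upper edge `1/(1 + a² + b²)`; rule (3) along `r` with the polynomial primitive
`4qD(r³/3 − D r⁴/4)` (`D = 1 + a² + b²`) and rule (1a) land on the RATIONAL dimension-2 representation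
`Q_q = [Q, q/(3(1 + a² + b²)²)]` (value `q·π/24`).  Assembly (three moves):
`[(0,1)⁴ ∩ {x₃² > x₀² + x₁² + x₂²}, q] − Q_q ∈ KZ.relations`, whence `cone4_twoDescent` — the
Lorentzian quadric 4-cell descends to the closure of rational representations of dimension `≤ 2`
inside the rules.  0 sorry.  [KontsevichZagier2001 §1.2 rules (1), (3)]
-/

noncomputable section

open Literature.NumberTheory.Transcendental
open MeasureTheory Set
open MvPolynomial (aeval X C)
open Literature.ModelTheory.ExponentialFields (IsSemialgebraic isSemialgebraic_setOf_eval_pos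
  isSemialgebraic_setOf_eval_lt continuous_aeval_real)
open Summit.KontsevichZagierPeriods.RootDecompWalshStrata.WalshSpanProof (isSemialgebraic_cubeSet
  isBounded_cubeSet cellRep cellRep_domain cellRep_integrand)
open Summit.KontsevichZagierPeriods.RootDecompWalshStrata.ConeSpecimen (cubeCell_subset_Icc discPoly
  aeval_discPoly discBase isSemialgebraic_discBase)

namespace Summit.KontsevichZagierPeriods.RootDecompWalshStrata.Cone4

/-! #### The rational 2-cell `Q_q` on the quarter disc -/

/-- Membership in the quarter disc `Q`, in coordinates. [definition] -/
theorem mem_discBase {t : Fin 2 → ℝ} :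
    t ∈ discBase ↔ ((0 < t 0 ∧ t 0 < 1) ∧ (0 < t 1 ∧ t 1 < 1)) ∧ 0 < 1 - t 0 ^ 2 - t 1 ^ 2 := by
  simp only [discBase, mem_setOf_eq, aeval_discPoly]
  exact ⟨fun ⟨hu, hc⟩ => ⟨⟨hu 0, hu 1⟩, hc⟩, fun ⟨⟨h0, h1⟩, hc⟩ =>
    ⟨fun j => by fin_cases j <;> assumption, hc⟩⟩

/-- Membership of `Fin.init w` in `Q`, in the coordinates of `w`. [definition] -/
theorem init_mem_discBase {w : Fin 3 → ℝ} :
    Fin.init w ∈ discBase ↔ ((0 < w 0 ∧ w 0 < 1) ∧ (0 < w 1 ∧ w 1 < 1)) ∧ 0 < 1 - w 0 ^ 2 - w 1 ^ 2 := by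
  rw [mem_discBase]
  rfl

/-- `Q ⊆ [0,1]²`. [folklore] -/
theorem discBase_subset_Icc : discBase ⊆ Icc 0 1 := cubeCell_subset_Icc discPoly

/-- The weight `q/(3(1 + a² + b²)²)` is continuous on `ℝ²`. [folklore] -/
theorem continuous_wQ (q : ℚ) :
    Continuous fun t : Fin 2 → ℝ => (q : ℝ) / (3 * (1 + t 0 ^ 2 + t 1 ^ 2) ^ 2) :=
  continuous_const.div (by fun_prop) fun t => by positivity

/-- `Q_q = [Q, q/(3(1 + a² + b²)²)]`: a RATIONAL function on the quarter disc (value `q·π/24`).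
[KontsevichZagier2001 §1.1] -/
def qdRep (q : ℚ) : KZ.IntegralRep 2 where
  domain := discBase
  integrand t := (q : ℝ) / (3 * (1 + t 0 ^ 2 + t 1 ^ 2) ^ 2)
  isSemialgebraic_domain := isSemialgebraic_discBase
  isSemialgebraicFunOn_integrand :=
    (isSemialgebraicFunOn_aeval_div_aeval isSemialgebraic_discBase (C q) (3 * (1 + X 0 ^ 2 + X 1 ^ 2) ^ 2)
      fun t _ => by
        have h : (0:ℝ) < 3 * (1 + t 0 ^ 2 + t 1 ^ 2) ^ 2 := by positivity
        simpa using h.ne').congr fun t _ => by simp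
  integrableOn :=
    ((continuous_wQ q).continuousOn.integrableOn_compact isCompact_Icc).mono_set discBase_subset_Icc

/-- The domain of `Q_q`. [definition] -/
@[simp] theorem qdRep_domain (q : ℚ) : (qdRep q).domain = discBase := rfl

/-- The integrand of `Q_q`. [definition] -/
@[simp] theorem qdRep_integrand (q : ℚ) (t : Fin 2 → ℝ) :
    (qdRep q).integrand t = (q : ℝ) / (3 * (1 + t 0 ^ 2 + t 1 ^ 2) ^ 2) := rfl

/-- **`Q_q` is a rational representation of dimension 2.** [KontsevichZagier2001 §1.1] -/
theorem isRational_qdRep (q : ℚ) : (qdRep q).IsRational := by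
  refine ⟨C q, 3 * (1 + X 0 ^ 2 + X 1 ^ 2) ^ 2, fun t _ => ?_, fun t _ => ?_⟩
  · have h : (0:ℝ) < 3 * (1 + t 0 ^ 2 + t 1 ^ 2) ^ 2 := by positivity
    simpa using h.ne'
  · simp

/-! #### The band: `Π` is the open band `0 < r < 1/(1 + a² + b²)` over `Q` -/

/-- Coordinates of `Fin.snoc` on `ℝ² × ℝ`. [definition] -/
@[simp] private theorem snoc₂_apply (t : Fin 2 → ℝ) (s : ℝ) :
    (Fin.snoc t s : Fin 3 → ℝ) 2 = s ∧ (Fin.snoc t s : Fin 3 → ℝ) 0 = t 0 ∧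
      (Fin.snoc t s : Fin 3 → ℝ) 1 = t 1 := ⟨rfl, rfl, rfl⟩

/-- The upper edge `1/(1 + a² + b²)`. -/
def capEdge (t : Fin 2 → ℝ) : ℝ := 1 / (1 + t 0 ^ 2 + t 1 ^ 2)

/-- The upper edge is `ℚ`-semialgebraic (a rational function). [BCR1998 §2.2] -/
theorem isSemialgebraicFunOn_capEdge : IsSemialgebraicFunOn ℚ discBase capEdge :=
  (isSemialgebraicFunOn_aeval_div_aeval isSemialgebraic_discBase 1 (1 + X 0 ^ 2 + X 1 ^ 2)
    fun t _ => by
      have h : (0:ℝ) < 1 + t 0 ^ 2 + t 1 ^ 2 := by positivity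
      simpa using h.ne').congr fun t _ => by simp [capEdge]

/-- `0 < 1/(1 + a² + b²) ≤ 1`. [folklore] -/
theorem capEdge_pos_le_one (t : Fin 2 → ℝ) : 0 < capEdge t ∧ capEdge t ≤ 1 := by
  have h : (0:ℝ) < 1 + t 0 ^ 2 + t 1 ^ 2 := by positivity
  refine ⟨one_div_pos.2 h, (div_le_one h).2 ?_⟩
  nlinarith [sq_nonneg (t 0), sq_nonneg (t 1)]

/-- Membership in `Π` in band form. [folklore] -/
theorem mem_pySet_iff_init (w : Fin 3 → ℝ) :
    w ∈ pySet ↔ Fin.init w ∈ discBase ∧ 0 < w (Fin.last 2) ∧ w (Fin.last 2) < capEdge (Fin.init w) := by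
  rw [mem_pySet]
  have hb : capEdge (Fin.init w) = 1 / (1 + w 0 ^ 2 + w 1 ^ 2) := rfl
  have hl : w (Fin.last 2) = w 2 := rfl
  have hD : (0:ℝ) < 1 + w 0 ^ 2 + w 1 ^ 2 := by positivity
  rw [init_mem_discBase, hb, hl]
  constructor
  · rintro ⟨⟨h0, h1, h2⟩, hdisc, hcap⟩
    refine ⟨⟨⟨h0, h1⟩, hdisc⟩, h2.1, ?_⟩
    rw [lt_div_iff₀ hD]
    linarith
  · rintro ⟨⟨⟨h0, h1⟩, hdisc⟩, hlo, hlt⟩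
    have hwD : w 2 * (1 + w 0 ^ 2 + w 1 ^ 2) < 1 := (lt_div_iff₀ hD).1 hlt
    refine ⟨⟨h0, h1, hlo, ?_⟩, hdisc, by linarith⟩
    nlinarith [sq_nonneg (w 0), sq_nonneg (w 1)]

/-- The closed band `0 ≤ r ≤ 1/(1 + a² + b²)` over `Q` lies in `[0,1]³`. [folklore] -/
theorem band_discBase_subset_Icc : KZlog.band discBase (fun _ => (0:ℝ)) capEdge ⊆ Icc 0 1 := by
  intro w hw
  rw [KZlog.mem_band] at hw
  obtain ⟨hu, h0, h1⟩ := hw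
  have hu' := (init_mem_discBase.1 hu).1
  have hcap := (capEdge_pos_le_one (Fin.init w)).2
  have hl : w (Fin.last 2) = w 2 := rfl
  rw [hl] at h0 h1
  refine ⟨fun j => ?_, fun j => ?_⟩
  · fin_cases j
    · exact hu'.1.1.le
    · exact hu'.2.1.le
    · exact h0
  · fin_cases j
    · exact hu'.1.2.le
    · exact hu'.2.2.le
    · exact h1.trans hcap

/-! #### Moves (3) + (1a): `[Π, …] ≡ Q_q` -/

/-- **Moves (3) + (1a):** Newton–Leibniz along `r` with the polynomial primitive
`4qD(r³/3 − D r⁴/4)`, `D = 1 + a² + b²`, over `Q` (closed fibres `[0, 1/D]`), then opening the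
fibres: `[Π, q(1 − rD)·4r²D] − Q_q ∈ KZ.relations`. [KontsevichZagier2001 §1.2 rules (1), (3)] -/
theorem of_pyRep_sub_of_qdRep_mem_relations (q : ℚ) :
    KZ.of (pyRep q) - KZ.of (qdRep q) ∈ KZ.relations := by
  have hBs := isSemialgebraic_discBase
  have ha : IsSemialgebraicFunOn ℚ discBase (fun _ => (0:ℝ)) := by
    simpa using isSemialgebraicFunOn_ratCast hBs 0
  have hb : IsSemialgebraicFunOn ℚ discBase capEdge := isSemialgebraicFunOn_capEdge
  have hab : ∀ t ∈ discBase, (fun _ => (0:ℝ)) t ≤ capEdge t := fun t _ => (capEdge_pos_le_one t).1.le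
  have hband : IsSemialgebraic ℚ (KZlog.band discBase (fun _ => (0:ℝ)) capEdge) :=
    KZlog.isSemialgebraic_band ha hb
  set F : (Fin 3 → ℝ) → ℝ := fun w =>
    4 * (q : ℝ) * (1 + w 0 ^ 2 + w 1 ^ 2) *
      (w 2 ^ 3 / 3 - (1 + w 0 ^ 2 + w 1 ^ 2) * w 2 ^ 4 / 4) with hFdef
  have hbdry : ∀ t ∈ discBase,
      F (Fin.snoc t (capEdge t)) - F (Fin.snoc t ((fun _ => (0:ℝ)) t)) = (qdRep q).integrand t := by
    intro t _
    have hD : (1 + t 0 ^ 2 + t 1 ^ 2 : ℝ) ≠ 0 := by positivity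
    simp only [hFdef, snoc₂_apply, qdRep_integrand, capEdge]
    field_simp
    ring
  obtain ⟨rb, rd, hrbd, hrbi, hrdd, hrdi, hrel⟩ := KZ.exists_band_newtonLeibniz hBs
    (fun _ => (0:ℝ)) capEdge ha hb hab F
    (fun w => (q : ℝ) * (1 - w 2 * (1 + w 0 ^ 2 + w 1 ^ 2)) * (4 * w 2 ^ 2 * (1 + w 0 ^ 2 + w 1 ^ 2)))
    ((isSemialgebraicFunOn_aeval hband (4 * C q * (1 + X 0 ^ 2 + X 1 ^ 2) *
      (C (1 / 3) * X 2 ^ 3 - (1 + X 0 ^ 2 + X 1 ^ 2) * (C (1 / 4) * X 2 ^ 4)))).congr fun w _ => by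
        simp only [hFdef, map_mul, map_sub, map_add, map_pow, map_one, map_ofNat, MvPolynomial.aeval_C,
          MvPolynomial.aeval_X, eq_ratCast]
        push_cast
        ring)
    ((isSemialgebraicFunOn_aeval hband
      (C q * (1 - X 2 * (1 + X 0 ^ 2 + X 1 ^ 2)) * (4 * X 2 ^ 2 * (1 + X 0 ^ 2 + X 1 ^ 2)))).congr
      fun w _ => by simp)
    (fun t _ => by
      simp only [hFdef, snoc₂_apply]
      fun_prop)
    (fun t _ s _ => by
      simp only [hFdef, snoc₂_apply]
      exact ((((hasDerivAt_pow 3 s).div_const 3).sub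
        (((hasDerivAt_pow 4 s).const_mul (1 + t 0 ^ 2 + t 1 ^ 2)).div_const 4)).const_mul
        (4 * (q : ℝ) * (1 + t 0 ^ 2 + t 1 ^ 2))).congr_deriv (by push_cast; ring))
    (((continuous_wPy q).continuousOn.integrableOn_compact isCompact_Icc).mono_set
      band_discBase_subset_Icc)
    ((qdRep q).isSemialgebraicFunOn_integrand.congr fun t ht => (hbdry t ht).symm)
    (((qdRep q).integrableOn.congr_fun (fun t ht => (hbdry t ht).symm)
      isSemialgebraic_discBase.measurableSet_holds))
  obtain ⟨rb', hrb'd, hrb'i, hrel'⟩ := KZ.of_sub_of_restrict_openBand_mem_relations ha hb rb hrbd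
  have hpin1 : KZ.of rb' - KZ.of (pyRep q) ∈ KZ.relations := by
    refine KZ.of_sub_of_mem_relations_of_eqOn ?_ fun w _ => ?_
    · rw [hrb'd, pyRep_domain]
      ext w
      exact mem_pySet_iff_init w
    · rw [hrb'i, hrbi]
      rfl
  have hpin2 : KZ.of rd - KZ.of (qdRep q) ∈ KZ.relations := by
    refine KZ.of_sub_of_mem_relations_of_eqOn ?_ fun t ht => ?_
    · rw [qdRep_domain, hrdd]
    · rw [hrdi]
      rw [hrdd] at ht
      exact hbdry t ht
  have : KZ.of (pyRep q) - KZ.of (qdRep q) =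
      (KZ.of rb - KZ.of rd) - (KZ.of rb - KZ.of rb') - (KZ.of rb' - KZ.of (pyRep q)) +
        (KZ.of rd - KZ.of (qdRep q)) := by abel
  rw [this]
  exact add_mem (sub_mem (sub_mem hrel hrel') hpin1) hpin2

/-! #### Assembly: the cone cell lands on the rational 2-cell `Q_q` -/

/-- **`[(0,1)⁴ ∩ {x₃² > x₀² + x₁² + x₂²}, q] − Q_q ∈ KZ.relations`:** the Lorentzian quadric 4-cell
with constant weight `q` is equivalent under the three KZ rules to the RATIONAL dimension-2
representation `Q_q = [Q, q/(3(1 + a² + b²)²)]` (three moves; `q·π/24` both sides).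
[KontsevichZagier2001 §1.2; this node] -/
theorem of_cell_sub_of_qdRep_mem_relations (q : ℚ) :
    KZ.of (cellRep cone4Poly q) - KZ.of (qdRep q) ∈ KZ.relations := by
  have h1 := of_cell_sub_of_b3NRep_mem_relations q
  have h2 := of_pyRep_sub_of_b3NRep_mem_relations q
  have h3 := of_pyRep_sub_of_qdRep_mem_relations q
  have : KZ.of (cellRep cone4Poly q) - KZ.of (qdRep q) =
      (KZ.of (cellRep cone4Poly q) - KZ.of (b3NRep q)) - (KZ.of (pyRep q) - KZ.of (b3NRep q)) +
        (KZ.of (pyRep q) - KZ.of (qdRep q)) := by abel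
  rw [this]
  exact add_mem (sub_mem h1 h2) h3

/-- **The cone cell is an instance of the `d = 4` quadric descent** (`P = x₃² − x₀² − x₁² − x₂²`,
any rational weight `q`): every representation with the cone cell as domain and integrand `q` is
equivalent, modulo `KZ.relations`, to an element of the closure of the RATIONAL representations of
dimension `≤ 2`.  Decided INSIDE the rules; the `P := cone4Poly` instance of `QuadricTwoDescentFour`
(gen-11 node).  [KontsevichZagier2001 §1.2; this node] -/
theorem cone4_twoDescent (q : ℚ) (ρ : KZ.IntegralRep 4)
    (hρ : ρ.domain = {x | (∀ j, 0 < x j ∧ x j < 1) ∧ 0 < MvPolynomial.aeval x cone4Poly} ∧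
      ∀ x ∈ ρ.domain, ρ.integrand x = (q : ℝ)) :
    ∃ y ∈ AddSubgroup.closure
        {y : KZ.FormalRep | ∃ (m : ℕ) (N : KZ.IntegralRep m), m ≤ 2 ∧ N.IsRational ∧ y = KZ.of N},
      KZ.of ρ - y ∈ KZ.relations := by
  refine ⟨KZ.of (qdRep q),
    AddSubgroup.subset_closure ⟨2, qdRep q, le_rfl, isRational_qdRep q, rfl⟩, ?_⟩
  have hpin : KZ.of ρ - KZ.of (cellRep cone4Poly q) ∈ KZ.relations :=
    KZ.of_sub_of_mem_relations_of_eqOn hρ.1.symm fun x hx => by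
      rw [hρ.2 x hx, cellRep_integrand]
  have : KZ.of ρ - KZ.of (qdRep q) =
      (KZ.of ρ - KZ.of (cellRep cone4Poly q)) +
        (KZ.of (cellRep cone4Poly q) - KZ.of (qdRep q)) := by abel
  rw [this]
  exact add_mem hpin (of_cell_sub_of_qdRep_mem_relations q)

end Summit.KontsevichZagierPeriods.RootDecompWalshStrata.Cone4

end
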